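import Literature.AlgebraicGeometry.Motives.AbelianVarietyProductIsogeny
import HarnessLib

/-!
# The product base-change square `A₁ × A₂ → A₁ × B₂` over a homomorphism `A₂ → B₂` is cartesian

Topic `AlgebraicGeometry/Motives`; namespace `Literature.AlgebraicGeometry.Motives(.AbelianVariety)`.
THEOREMS ONLY (no definition, no named fact, no instance, no `sorry`; net Literature debt 0).

For abelian varieties over a field `k` and a homomorphism `g : A₂ → B₂`, the square of underlying schemes
```
A₁ ×ₖ A₂ ──snd──▶ A₂
   │ 1 × g           │ g
   ▼                 ▼
A₁ ×ₖ B₂ ──snd──▶ B₂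
```
is a pull-back square (`isPullback_snd_prodMap_id`), and so is its mirror image for `g × 1` and the first
projections (`isPullback_fst_prodMap_id`); the projections `A ×ₖ B → B`, `A ×ₖ B → A` are flat
(`flat_toSchemeHom_snd`, `flat_toSchemeHom_fst`: base changes of the structure morphisms, which are flat over a
field).  This is elementary pasting of fibre-product squares over `Spec k` ([GortzWedhorn2020, Prop. 4.16 and
(4.8)–(4.10): «`(X ×_S Y) ×_Y Y′ = X ×_S Y′`», transitivity of fibre products) —
recorded by name because it is the cartesian-square hypothesis `H : IsPullback f′ p′ p f` (with `f′ = snd`,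
`p′ = (1 × φ).left`, `p = φ.left`, `f = snd`) of the tree's flat base change of finite-group geometric quotients
`RelativeSpec.ActionOver.isGeometricQuotient_baseChange_of_flat` ([SGA1, Exp. V Prop. 1.9]) when the quotient
`φ : A → A/K` by a finite subgroup is multiplied by a factor `A₁` (cell `hodgecm-mathlib`, J0a road (c): `1 × φ_Θ`
is a geometric quotient of `A × A` by `K(Θ)` acting on the second factor).

Also the underlying general statement in any category: for `a : X → S`, `b : Y → S` and `g : Y′ → Y`, the square
`X ×_S Y′ → Y′`, `X ×_S Y′ → X ×_S Y` (`pullback.map` with identities), `g`, `X ×_S Y → Y` is a pull-back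
(`isPullback_pullbackSnd_map_id`), and its mirror (`isPullback_pullbackFst_map_id`).

HC_CM is proved only modulo the 7 printed citations until rung 0 closes.

## References
* [GortzWedhorn2020] U. Görtz, T. Wedhorn, *Algebraic Geometry I: Schemes*, 2nd ed. (2020), §(4.8)–(4.10), Prop. 4.16,
  Prop. 14.3 (flatness is stable under base change).
* [SGA1] A. Grothendieck, *Revêtements étales et groupe fondamental*, Exp. V Prop. 1.9.
* [MumfordAV1970] D. Mumford, *Abelian Varieties* (1970), §7 Thm. p. 66 and §19.
-/

noncomputable section

universe v u

open CategoryTheory CategoryTheory.Limits AlgebraicGeometry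

namespace Literature.AlgebraicGeometry.Motives

/-! ### The general pasting statement -/

section General

variable {C : Type u} [Category.{v} C] {X Y Y' S : C}

/-- **`X ×_S Y′ = (X ×_S Y) ×_Y Y′`, second-projection form.**  For `a : X → S`, `b : Y → S`, `b′ : Y′ → S` and
`g : Y′ → Y` over `S` (`g ≫ b = b′`), the square with top `snd : X ×_S Y′ → Y′`, left
`X ×_S Y′ → X ×_S Y` (the map induced by `𝟙 × g`), right `g` and bottom `snd : X ×_S Y → Y` is a pull-back
(pasting: the outer rectangle down to `a : X → S` is the pull-back square of `a, b′`, the lower square that of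
`a, b`). [cite: GortzWedhorn2020, §(4.8)–(4.10) and Prop. 4.16] -/
theorem isPullback_pullbackSnd_map_id (a : X ⟶ S) (b : Y ⟶ S) (b' : Y' ⟶ S) (g : Y' ⟶ Y) (w : g ≫ b = b')
    [HasPullback a b] [HasPullback a b']
    (e₁ : a ≫ 𝟙 S = 𝟙 X ≫ a) (e₂ : b' ≫ 𝟙 S = g ≫ b) :
    IsPullback (pullback.snd a b') (pullback.map a b' a b (𝟙 X) g (𝟙 S) e₁ e₂) g (pullback.snd a b) := by
  refine IsPullback.of_bot ?_ (pullback.lift_snd _ _ _).symm (IsPullback.of_hasPullback a b).flip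
  have h : pullback.map a b' a b (𝟙 X) g (𝟙 S) e₁ e₂ ≫ pullback.fst a b = pullback.fst a b' := by
    rw [pullback.lift_fst, Category.comp_id]
  rw [h, w]
  exact (IsPullback.of_hasPullback a b').flip

/-- **`Y′ ×_S X = Y′ ×_Y (Y ×_S X)`, first-projection form** (mirror image of `isPullback_pullbackSnd_map_id`):
the square with top `fst : Y′ ×_S X → Y′`, left `Y′ ×_S X → Y ×_S X` (induced by `g × 𝟙`), right `g` and bottom
`fst : Y ×_S X → Y` is a pull-back. [cite: GortzWedhorn2020, §(4.8)–(4.10) and Prop. 4.16] -/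
theorem isPullback_pullbackFst_map_id (b : Y ⟶ S) (b' : Y' ⟶ S) (a : X ⟶ S) (g : Y' ⟶ Y) (w : g ≫ b = b')
    [HasPullback b a] [HasPullback b' a]
    (e₁ : b' ≫ 𝟙 S = g ≫ b) (e₂ : a ≫ 𝟙 S = 𝟙 X ≫ a) :
    IsPullback (pullback.fst b' a) (pullback.map b' a b a g (𝟙 X) (𝟙 S) e₁ e₂) g (pullback.fst b a) := by
  refine IsPullback.of_bot ?_ (pullback.lift_fst _ _ _).symm (IsPullback.of_hasPullback b a)
  have h : pullback.map b' a b a g (𝟙 X) (𝟙 S) e₁ e₂ ≫ pullback.snd b a = pullback.snd b' a := by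
    rw [pullback.lift_snd, Category.comp_id]
  rw [h, w]
  exact IsPullback.of_hasPullback b' a

end General

/-! ### Abelian varieties: `1 × g` and `g × 1` -/

namespace AbelianVariety

variable {k : Type u} [Field k] {A₂ B₂ : AbelianVariety k}

/-- **The square `A₁ × A₂ —snd→ A₂`, `1 × g`, `g`, `A₁ × B₂ —snd→ B₂` is cartesian** — on underlying schemes,
`IsPullback snd (1 × g) g snd` — for every homomorphism `g : A₂ → B₂` of abelian varieties over `k` and every
`A₁` ([GortzWedhorn2020, (4.8)]: `A₁ ×ₖ A₂ = (A₁ ×ₖ B₂) ×_{B₂} A₂`).  With `g = φ_Θ : A → A/K(Θ)` this is the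
hypothesis `H : IsPullback f′ p′ p f` of ★ `RelativeSpec.ActionOver.isGeometricQuotient_baseChange_of_flat`
(`f′ = snd`, `p′ = (1 × φ_Θ).left`, `p = φ_Θ.left`, `f = snd`). [cite: GortzWedhorn2020, §(4.8)–(4.10) and Prop. 4.16]
[cite: SGA1, Exp. V Prop. 1.9] -/
theorem isPullback_snd_prodMap_id (A₁ : AbelianVariety k) (g : A₂ ⟶ B₂) :
    IsPullback (Hom.toSchemeHom (snd A₁ A₂)) (Hom.toSchemeHom (prodMap (𝟙 A₁) g))
      (Hom.toSchemeHom g) (Hom.toSchemeHom (snd A₁ B₂)) := by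
  rw [toSchemeHom_snd, toSchemeHom_snd, toSchemeHom_prodMap]
  exact isPullback_pullbackSnd_map_id A₁.X.hom B₂.X.hom A₂.X.hom (Hom.toSchemeHom g)
    (Over.w g.hom.hom.hom) _ _

/-- **Mirror image: the square `A₂ × A₁ —fst→ A₂`, `g × 1`, `g`, `B₂ × A₁ —fst→ B₂` is cartesian** — on
underlying schemes, `IsPullback fst (g × 1) g fst`. [cite: GortzWedhorn2020, §(4.8)–(4.10) and Prop. 4.16] -/
theorem isPullback_fst_prodMap_id (A₁ : AbelianVariety k) (g : A₂ ⟶ B₂) :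
    IsPullback (Hom.toSchemeHom (fst A₂ A₁)) (Hom.toSchemeHom (prodMap g (𝟙 A₁)))
      (Hom.toSchemeHom g) (Hom.toSchemeHom (fst B₂ A₁)) := by
  rw [toSchemeHom_fst, toSchemeHom_fst, toSchemeHom_prodMap]
  exact isPullback_pullbackFst_map_id B₂.X.hom A₂.X.hom A₁.X.hom (Hom.toSchemeHom g)
    (Over.w g.hom.hom.hom) _ _

/-- **The second projection `A ×ₖ B → B` is flat** (a base change of the structure morphism `A → Spec k`,
flat over a field; [GortzWedhorn2020, Prop. 14.3]).  This is the `[Flat f]` hypothesis of ★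
`RelativeSpec.ActionOver.isGeometricQuotient_baseChange_of_flat` for `f = snd`. [cite: GortzWedhorn2020, Prop. 14.3] -/
theorem flat_toSchemeHom_snd (A B : AbelianVariety k) : Flat (Hom.toSchemeHom (snd A B)) :=
  inferInstanceAs (Flat (pullback.snd A.X.hom B.X.hom))

/-- **The first projection `A ×ₖ B → A` is flat** (a base change of `B → Spec k`). [cite: GortzWedhorn2020, Prop. 14.3] -/
theorem flat_toSchemeHom_fst (A B : AbelianVariety k) : Flat (Hom.toSchemeHom (fst A B)) :=
  inferInstanceAs (Flat (pullback.fst A.X.hom B.X.hom))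

/-- The second projection `A ×ₖ B → B` is surjective (base change of the surjective `A → Spec k`, which has
the `k`-point `0`). [cite: GortzWedhorn2020, Prop. 4.32] -/
theorem surjective_toSchemeHom_snd (A B : AbelianVariety k) : Surjective (Hom.toSchemeHom (snd A B)) :=
  inferInstanceAs (Surjective (pullback.snd A.X.hom B.X.hom))

/-- The first projection `A ×ₖ B → A` is surjective. [cite: GortzWedhorn2020, Prop. 4.32] -/
theorem surjective_toSchemeHom_fst (A B : AbelianVariety k) : Surjective (Hom.toSchemeHom (fst A B)) :=
  inferInstanceAs (Surjective (pullback.fst A.X.hom B.X.hom))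

end AbelianVariety

end Literature.AlgebraicGeometry.Motives

end
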